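import Summits.Ventures.HodgeRepro2.T5SU11ResolventL2SchurWeighted

/-!
# The resolvent is symmetric on `L²(sinh 2t dt)` for every `λ > 1`

Row 523 proved `⟨G^I_λ g, h⟩ = ⟨g, G^I_λ h⟩` for two sources of the class at rates `> 1`. Here the rate hypotheses are
replaced by square-integrability: for two sources `g`, `h` of the class (rates `> 2 − λ`, which only make `G^I_λ g`,
`G^I_λ h` defined) with `g² sinh 2s, h² sinh 2t ∈ L¹(0, ∞)`,

* `two_mul_mul_le` — the arithmetic–geometric mean inequality `2ab ≤ a² x/y + b² y/x` (`x, y > 0`);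
* `integrable_prod_kernel_mul_mul` — **`K_λ(t, s) g(s) sinh 2s · h(t) sinh 2t` is integrable on `(0, ∞)²`**: it is dominated
  by `½ F_g(t, s) + ½ F_h(s, t)` with row 548's weighted integrands `F_g(t, s) = |K_λ(t, s)| (g(s)²/φ_{λ′}(s)) sinh 2s ·
  φ_{λ′}(t) sinh 2t` (any `1 < λ′ < λ`), through the symmetry of the kernel;
* `inner_greenSolI_symm_l2` — **`∫ (G^I_λ g) h sinh 2t = ∫ g (G^I_λ h) sinh 2s`** — Fubini.

Nothing is claimed about (N).

Blind lane: Mathlib + the HodgeRepro2 prefix only; no sorry; axioms ⊆ {propext, Classical.choice,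
Quot.sound}.
-/

namespace Summit.Ventures.HodgeRepro2.T5SU11ResolventSymmetricL2

open Filter Topology MeasureTheory
open Set (Ioi Ioc)
open T5SU11Cartan T5SU11SphericalFunction T5SU11SphericalDecay T5SU11RadialGreenKernel
  T5SU11RadialGreenImproper T5SU11RadialGreenImproperDecaySource T5SU11RadialGreenImproperStable
  T5SU11ResolventKernelComposition T5SU11ResolventTransformClass T5SU11RadialGreenPositivity
  T5SU11SphericalContinuous T5SU11SphericalBounds T5SU11ResolventL2SchurWeighted

/-- **The arithmetic–geometric mean inequality with weights**: `2ab ≤ a² (x/y) + b² (y/x)` for `x, y > 0`. -/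
theorem two_mul_mul_le (a b : ℝ) {x y : ℝ} (hx : 0 < x) (hy : 0 < y) :
    2 * (a * b) ≤ a ^ 2 * (x / y) + b ^ 2 * (y / x) := by
  have h : a ^ 2 * (x / y) + b ^ 2 * (y / x) - 2 * (a * b) = (a * x - b * y) ^ 2 / (x * y) := by
    field_simp
    ring
  have h0 : 0 ≤ (a * x - b * y) ^ 2 / (x * y) := div_nonneg (sq_nonneg _) (mul_pos hx hy).le
  linarith [h, h0]

section measure

variable [MeasurableSpace Circle] [BorelSpace Circle]

variable {lam lam' : ℝ} (hlam : 1 < lam) (h1 : 1 < lam') (h2 : lam' < lam)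
  {g : ℝ → ℝ} (hg : ContinuousOn g (Ioi 0))
  {M : ℝ} (hM : ∀ s ∈ Ioc (0 : ℝ) 1, |g s| ≤ M) (hM0 : 0 ≤ M)
  {ε C s₀ : ℝ} (hε : 2 - lam < ε) (hC : ∀ s, s₀ ≤ s → |g s| ≤ C * Real.exp (-ε * s))
  (hg2 : IntegrableOn (fun s => Real.sinh (2 * s) * g s ^ 2) (Ioi 0))
  {h : ℝ → ℝ} (hh : ContinuousOn h (Ioi 0))
  {M' : ℝ} (hM' : ∀ s ∈ Ioc (0 : ℝ) 1, |h s| ≤ M') (hM'0 : 0 ≤ M')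
  {ε' C' s₀' : ℝ} (hε' : 2 - lam < ε') (hC' : ∀ s, s₀' ≤ s → |h s| ≤ C' * Real.exp (-ε' * s))
  (hh2 : IntegrableOn (fun s => Real.sinh (2 * s) * h s ^ 2) (Ioi 0))

include hlam h1 h2 hg hg2 hh hh2 in
/-- **The product integrand `K_λ(t, s) g(s) sinh 2s · h(t) sinh 2t` is integrable on `(0, ∞)²`** for two continuous sources
with `g² sinh 2s, h² sinh 2t ∈ L¹(0, ∞)` (domination by row 548's weighted integrands, `1 < λ′ < λ`). -/
theorem integrable_prod_kernel_mul_mul :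
    Integrable (Function.uncurry fun t s => sphGreenKernel lam t s * g s * Real.sinh (2 * s) * (h t * Real.sinh (2 * t)))
      ((volume.restrict (Ioi 0)).prod (volume.restrict (Ioi 0))) := by
  have hχ : ContinuousOn (sphDecay lam) (Ioi 0) :=
    fun _ hr => (hasDerivAt_sphDecay hlam hr).continuousAt.continuousWithinAt
  have hFg := integrable_prod_kernel_sq_weighted hlam h1 h2 hg hg2
  have hFh := (integrable_prod_kernel_sq_weighted hlam h1 h2 hh hh2).swap
  have hdom := (hFg.const_mul (1 / 2)).add (hFh.const_mul (1 / 2))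
  rw [Measure.prod_restrict] at hdom ⊢
  -- measurability: the integrand is continuous on the open quadrant
  have hmeas : AEStronglyMeasurable (Function.uncurry fun t s => sphGreenKernel lam t s * g s * Real.sinh (2 * s)
      * (h t * Real.sinh (2 * t))) ((volume.prod volume).restrict (Ioi 0 ×ˢ Ioi 0)) := by
    refine ContinuousOn.aestronglyMeasurable ?_ (measurableSet_Ioi.prod measurableSet_Ioi)
    have hK : ContinuousOn (fun p : ℝ × ℝ => sphGreenKernel lam p.1 p.2) (Ioi 0 ×ˢ Ioi 0) := by
      simp only [sphGreenKernel, greenKernel]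
      apply ContinuousOn.neg
      apply ContinuousOn.mul
      · exact ((continuous_sph_hyp lam).comp (continuous_fst.min continuous_snd)).continuousOn
      · exact hχ.comp (continuous_fst.max continuous_snd).continuousOn
          (fun p hp => Set.mem_Ioi.mpr (lt_of_lt_of_le (Set.mem_Ioi.mp hp.1) (le_max_left _ _)))
    have hg' : ContinuousOn (fun p : ℝ × ℝ => g p.2) (Ioi 0 ×ˢ Ioi 0) :=
      hg.comp continuous_snd.continuousOn (fun p hp => hp.2)
    have hh' : ContinuousOn (fun p : ℝ × ℝ => h p.1) (Ioi 0 ×ˢ Ioi 0) :=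
      hh.comp continuous_fst.continuousOn (fun p hp => hp.1)
    exact ((hK.mul hg').mul (Real.continuous_sinh.comp (continuous_const.mul continuous_snd)).continuousOn).mul
      (hh'.mul (Real.continuous_sinh.comp (continuous_const.mul continuous_fst)).continuousOn)
  refine Integrable.mono' hdom hmeas ?_
  refine ae_restrict_of_forall_mem (measurableSet_Ioi.prod measurableSet_Ioi) (fun p hp => ?_)
  obtain ⟨t, s⟩ := p
  have ht0 : 0 < t := hp.1
  have hs0 : 0 < s := hp.2
  have hsinh_t : 0 ≤ Real.sinh (2 * t) := Real.sinh_nonneg_iff.mpr (by linarith)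
  have hsinh_s : 0 ≤ Real.sinh (2 * s) := Real.sinh_nonneg_iff.mpr (by linarith)
  have hφt : 0 < sph lam' (hyp t) := sph_hyp_pos lam' t
  have hφs : 0 < sph lam' (hyp s) := sph_hyp_pos lam' s
  simp only [Function.uncurry_apply_pair, Function.comp_apply, Prod.swap_prod_mk, Pi.add_apply, Real.norm_eq_abs]
  rw [abs_mul, abs_mul, abs_mul, abs_mul, abs_of_nonneg hsinh_t, abs_of_nonneg hsinh_s, sphGreenKernel_symm lam s t]
  -- `2 |g s| |h t| ≤ g(s)² φ′(t)/φ′(s) + h(t)² φ′(s)/φ′(t)`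
  have hamgm := two_mul_mul_le |g s| |h t| hφt hφs
  rw [sq_abs, sq_abs] at hamgm
  have hK0 : 0 ≤ |sphGreenKernel lam t s| := abs_nonneg _
  have hw : 0 ≤ |sphGreenKernel lam t s| * Real.sinh (2 * s) * Real.sinh (2 * t) :=
    mul_nonneg (mul_nonneg hK0 hsinh_s) hsinh_t
  calc |sphGreenKernel lam t s| * |g s| * Real.sinh (2 * s) * (|h t| * Real.sinh (2 * t))
      = (|sphGreenKernel lam t s| * Real.sinh (2 * s) * Real.sinh (2 * t)) * (|g s| * |h t|) := by ring
    _ ≤ (|sphGreenKernel lam t s| * Real.sinh (2 * s) * Real.sinh (2 * t))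
          * ((g s ^ 2 * (sph lam' (hyp t) / sph lam' (hyp s)) + h t ^ 2 * (sph lam' (hyp s) / sph lam' (hyp t))) / 2) := by
        apply mul_le_mul_of_nonneg_left _ hw
        linarith [hamgm]
    _ = 1 / 2 * (|sphGreenKernel lam t s| * (Real.sinh (2 * s) * g s ^ 2 / sph lam' (hyp s))
            * (sph lam' (hyp t) * Real.sinh (2 * t)))
        + 1 / 2 * (|sphGreenKernel lam t s| * (Real.sinh (2 * t) * h t ^ 2 / sph lam' (hyp t))
            * (sph lam' (hyp s) * Real.sinh (2 * s))) := by
        field_simp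

include hlam h1 h2 hg hM hM0 hε hC hg2 hh hM' hM'0 hε' hC' hh2 in
/-- **THE RESOLVENT IS SYMMETRIC ON `L²(sinh 2t dt)` FOR EVERY `λ > 1`**:
`∫_{(0,∞)} (G^I_λ g) h sinh 2t dt = ∫_{(0,∞)} g (G^I_λ h) sinh 2s ds` for two square-integrable sources of the class. -/
theorem inner_greenSolI_symm_l2 :
    ∫ t in Ioi 0, greenSolI (fun t => sph lam (hyp t)) (sphDecay lam) g t * h t * Real.sinh (2 * t)
      = ∫ s in Ioi 0, g s * greenSolI (fun t => sph lam (hyp t)) (sphDecay lam) h s * Real.sinh (2 * s) := by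
  have hF := integrable_prod_kernel_mul_mul hlam h1 h2 hg hg2 hh hh2
  have hswap := integral_integral_swap hF
  have hB := integrableOn_sph_mul_mul_sinh_Ioc hg hM hM0 lam
  have hA := integrableOn_sphDecay_mul_mul_sinh hlam hg hM hM0 hε hC
  have hB' := integrableOn_sph_mul_mul_sinh_Ioc hh hM' hM'0 lam
  have hA' := integrableOn_sphDecay_mul_mul_sinh hlam hh hM' hM'0 hε' hC'
  have hL : ∫ t in Ioi 0, ∫ s in Ioi 0, sphGreenKernel lam t s * g s * Real.sinh (2 * s) * (h t * Real.sinh (2 * t))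
      = ∫ t in Ioi 0, greenSolI (fun t => sph lam (hyp t)) (sphDecay lam) g t * h t * Real.sinh (2 * t) := by
    apply setIntegral_congr_fun measurableSet_Ioi
    intro t ht
    have ht0 : 0 < t := ht
    simp only
    rw [MeasureTheory.integral_mul_const, greenSolI_eq_integral_kernel hB hA ht0]
    simp only [sphGreenKernel]
    ring
  have hR : ∫ s in Ioi 0, ∫ t in Ioi 0, sphGreenKernel lam t s * g s * Real.sinh (2 * s) * (h t * Real.sinh (2 * t))
      = ∫ s in Ioi 0, g s * greenSolI (fun t => sph lam (hyp t)) (sphDecay lam) h s * Real.sinh (2 * s) := by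
    apply setIntegral_congr_fun measurableSet_Ioi
    intro s hs
    have hs0 : 0 < s := hs
    simp only
    have e : ∀ t, sphGreenKernel lam t s * g s * Real.sinh (2 * s) * (h t * Real.sinh (2 * t))
        = sphGreenKernel lam s t * h t * Real.sinh (2 * t) * (g s * Real.sinh (2 * s)) := by
      intro t
      rw [sphGreenKernel_symm lam t s]
      ring
    simp only [e]
    rw [MeasureTheory.integral_mul_const]
    simp only [sphGreenKernel]
    rw [← greenSolI_eq_integral_kernel hB' hA' hs0]
    ring
  rw [← hL, hswap, hR]

end measure

end Summit.Ventures.HodgeRepro2.T5SU11ResolventSymmetricL2
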